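import Mathlib
import Summits.NavierStokesRegularity.FluidComputer.GalerkinEmergenceTrue
import Summits.NavierStokesRegularity.FluidComputer.GalerkinCertificateTransfer

/-!
# KEEP and KILL for the true trajectory from ONE head∣tail certificate: the end-to-end statement (instab g15, cell `ns-blowup`, 2026-08-26)

HONEST FRAMING (human ruling D-0035): nothing here is a claim about Navier–Stokes blow-up.
WHAT THIS IS NOT: not NS evidence. This file is the citable END-TO-END form of the lineage's
abstract chain (`instab/INSTAB-BRIDGE.md` l.126–l.131): it packages
`GalerkinEmergenceTrue.half_prediction_of_galerkin_limit` / `decay_two_of_galerkin_limit` (g15)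
with the transfer lemmas of `GalerkinCertificateTransfer` (g15), so that the hypotheses are the
PRIMITIVE objects an implementer holds:

* a `Literature.Analysis.ODE.GalerkinConvergenceSetting P F W Z T l u` (WZ25 engine: compact
  Galerkin-invariant `W`, `F` continuous on `W`, one one-sided Lipschitz constant for all levels,
  Galerkin solutions on `[0, T]` staying in `W`) — the model-specific item (β);
* the field splits on `W` as `F w = A w + B (w, w)` (`A`, `B` as functions `E → E`; only their values
  on finitely supported vectors and on `W` matter);
* bounded level generators `A_n` realising the EXTENSION `A_n w = P_n (A (P_n w)) + μ (w − P_n w)`;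
* ONE set of block weights `G₁, G₂, D₁` (two-level pair) and `G` (strong pair), symmetric,
  `P_n`-compatible (`⟪G w, P_n z⟫ = ⟪G (P_n w), z⟫`), with the norm comparisons
  `m₂‖x‖² ≤ Re⟪G₂x,x⟫`, `Re⟪G₁x,x⟫ ≤ M₁ Re⟪D₁x,x⟫`, `m‖x‖² ≤ Re⟪Gx,x⟫ ≤ M‖x‖²`;
* THE CERTIFICATE: the three inequalities `2Re⟪G₁p, Ap⟫ + c Re⟪G₂p, p⟫ ≤ 2ω Re⟪G₁p, p⟫`,
  `Re⟪G₂p, Ap⟫ ≤ ω Re⟪G₂p, p⟫`, `Re⟪Gp, Ap⟫ ≤ ω₁ Re⟪Gp, p⟫` for `p = P_n w` (finitely supported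
  vectors), all levels; plus the tail inequality `2μ Re⟪G₁q,q⟫ + c Re⟪G₂q,q⟫ ≤ 2ω Re⟪G₁q,q⟫` on
  `ker P_n` and `μ ≤ min(ω₁, ω)` (choice of the extension rate);
* the bilinear loss (B) `√Re⟪D₁ B(x,y), B(x,y)⟫ ≤ c_alg ‖x‖ ‖y‖`;
* KEEP: a normalised `v`, a rate `λ ≥ 0` with `2λ > ω`, the eigen-consistency
  `‖A_n (P_n v) − λ P_n v‖ → 0` (`= ‖P_n A (v − P_n v)‖` for a true eigenvector,
  `GalerkinCertificateTransfer.norm_eigen_residual_ext`), a margin constant `C' > C`;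
  KILL: `ω < 2λ ≤ 0`, `ω₁ ≤ λ`, a seed with `√(M/m)‖x‖ < ε`, `4Cε < 1`.

Conclusions: `half_prediction_of_head_tail_certificate` — every classical solution of the full
system in `W` from `ε v` has `‖w t‖ ≥ ε e^{λt}/2` wherever `ε e^{λt} ≤ 2/(9C')` (R-β: amplitude
floor and clock); `decay_two_of_head_tail_certificate` — every classical solution in `W` from `x`
has `‖w t‖ ≤ 2 ε e^{λt}` on `[0, T]` (basin radius `ε₀ = 1/(4C)`), `C = √(M₁/(c m₂))·c_alg·√(π/(2λ−ω))`.
Mathlib + the two cited tree files; no new definitions.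
-/

noncomputable section

namespace Summit.NavierStokesRegularity.FluidComputer.GalerkinEmergenceCertificate

open Set Filter Topology RCLike
open scoped InnerProductSpace
open Summit.NavierStokesRegularity.FluidComputer.GalerkinEmergenceTrue
open Summit.NavierStokesRegularity.FluidComputer.GalerkinCertificateTransfer
open Literature.Analysis.ODE

variable {𝕜 E : Type*} [RCLike 𝕜] [NormedAddCommGroup E] [InnerProductSpace 𝕜 E]
  [NormedSpace ℝ E] [CompleteSpace E]
  {P : ℕ → E →L[ℝ] E} {F : E → E} {W Z : Set E} {T l : ℝ} {u : ℕ → E → ℝ → E}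

/-- **KEEP (R-β amplitude floor and clock) FOR THE TRUE TRAJECTORY FROM ONE HEAD∣TAIL CERTIFICATE.**
See the module docstring for the list of hypotheses; the conclusion is: every classical solution
`w` of the full system `w' = F (w)` on `(0, T)`, continuous on `[0, T]`, with `w 0 = ε v ∈ Z`,
staying in `W`, obeys `‖w t‖ ≥ ε e^{λt}/2` at every `t ∈ [0, T]` with `ε e^{λt} ≤ 2/(9 C')`. -/
theorem half_prediction_of_head_tail_certificate (h : GalerkinConvergenceSetting P F W Z T l u)
    {A : E → E} {B : E → E → E} (hF : ∀ w ∈ W, F w = A w + B w w)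
    (An : ℕ → E →L[ℝ] E) {μ : ℝ}
    (hAn : ∀ n, ∀ w : E, An n w = P n (A (P n w)) + ((μ : 𝕜) • (w - P n w)))
    {G₁ G₂ D₁ G : E →L[ℝ] E}
    (hG₁ : ∀ x y : E, ⟪G₁ x, y⟫_𝕜 = ⟪x, G₁ y⟫_𝕜) (hG₂ : ∀ x y : E, ⟪G₂ x, y⟫_𝕜 = ⟪x, G₂ y⟫_𝕜)
    (hG : ∀ x y : E, ⟪G x, y⟫_𝕜 = ⟪x, G y⟫_𝕜)
    (hG₁P : ∀ n, ∀ w z : E, ⟪G₁ w, P n z⟫_𝕜 = ⟪G₁ (P n w), z⟫_𝕜)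
    (hG₂P : ∀ n, ∀ w z : E, ⟪G₂ w, P n z⟫_𝕜 = ⟪G₂ (P n w), z⟫_𝕜)
    (hD₁P : ∀ n, ∀ w z : E, ⟪D₁ w, P n z⟫_𝕜 = ⟪D₁ (P n w), z⟫_𝕜)
    (hGP : ∀ n, ∀ w z : E, ⟪G w, P n z⟫_𝕜 = ⟪G (P n w), z⟫_𝕜)
    (hG₁pos : ∀ x : E, 0 ≤ re ⟪G₁ x, x⟫_𝕜) {ω c m₂ M₁ : ℝ} (hc : 0 < c) (hm₂ : 0 < m₂)
    (hM₁ : 0 ≤ M₁) (hm₂' : ∀ x : E, m₂ * ‖x‖ ^ 2 ≤ re ⟪G₂ x, x⟫_𝕜)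
    (hD₁ : ∀ x : E, 0 ≤ re ⟪D₁ x, x⟫_𝕜) (hM₁' : ∀ x : E, re ⟪G₁ x, x⟫_𝕜 ≤ M₁ * re ⟪D₁ x, x⟫_𝕜)
    {m M ω₁ : ℝ} (hm0 : 0 < m) (hm : ∀ x : E, m * ‖x‖ ^ 2 ≤ re ⟪G x, x⟫_𝕜)
    (hM : ∀ x : E, re ⟪G x, x⟫_𝕜 ≤ M * ‖x‖ ^ 2)
    (h₁ : ∀ n, ∀ w : E, 2 * re ⟪G₁ (P n w), A (P n w)⟫_𝕜 + c * re ⟪G₂ (P n w), P n w⟫_𝕜 ≤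
      2 * ω * re ⟪G₁ (P n w), P n w⟫_𝕜)
    (h₂ : ∀ n, ∀ w : E, re ⟪G₂ (P n w), A (P n w)⟫_𝕜 ≤ ω * re ⟪G₂ (P n w), P n w⟫_𝕜)
    (hL : ∀ n, ∀ w : E, re ⟪G (P n w), A (P n w)⟫_𝕜 ≤ ω₁ * re ⟪G (P n w), P n w⟫_𝕜)
    (hμ₁ : μ ≤ ω₁) (hμ₂ : μ ≤ ω)
    (htail : ∀ n, ∀ q : E, P n q = 0 →
      2 * μ * re ⟪G₁ q, q⟫_𝕜 + c * re ⟪G₂ q, q⟫_𝕜 ≤ 2 * ω * re ⟪G₁ q, q⟫_𝕜)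
    {calg : ℝ} (hcalg : 0 ≤ calg)
    (hB : ∀ x y : E, Real.sqrt (re ⟪D₁ (B x y), B x y⟫_𝕜) ≤ calg * ‖x‖ * ‖y‖)
    {v : E} (hv1 : ‖v‖ = 1) {lam ε : ℝ} (hgap : ω < 2 * lam) (hlam : 0 ≤ lam) (hε : 0 < ε)
    (hx : ε • v ∈ Z)
    (hres : Tendsto (fun n => ‖An n (P n v) - lam • P n v‖) atTop (𝓝 0))
    {C' : ℝ}
    (hCC' : Real.sqrt (M₁ / (c * m₂)) * calg * Real.sqrt (Real.pi / (2 * lam - ω)) < C')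
    (hsmall : ∀ t ∈ Icc 0 T, C' * (3 / 2 : ℝ) ^ 2 * (ε * Real.exp (lam * t)) < 3 / 2 - 1)
    {w : ℝ → E} (hw : ContinuousOn w (Icc 0 T)) (hw0 : w 0 = ε • v)
    (hw' : ∀ t ∈ Ioo 0 T, HasDerivAt w (F (w t)) t) (hwW : ∀ t ∈ Icc 0 T, w t ∈ W)
    {t : ℝ} (ht : t ∈ Icc 0 T) (hχ : ε * Real.exp (lam * t) ≤ 2 / (9 * C')) :
    ε * Real.exp (lam * t) / 2 ≤ ‖w t‖ := by
  have hPidem : ∀ n, ∀ w : E, P n (P n w) = P n w := fun n w => h.proj_comp n n le_rfl w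
  have hG₂pos : ∀ x : E, 0 ≤ re ⟪G₂ x, x⟫_𝕜 := fun x =>
    le_trans (mul_nonneg hm₂.le (sq_nonneg _)) (hm₂' x)
  have hGpos : ∀ x : E, 0 ≤ re ⟪G x, x⟫_𝕜 := fun x =>
    le_trans (mul_nonneg hm0.le (sq_nonneg _)) (hm x)
  exact half_prediction_of_galerkin_limit (𝕜 := 𝕜) h An (fun n x y => P n (B x y))
    (fun n => galerkin_field_ext (𝕜 := 𝕜) hF (hAn n))
    (G₁ := fun _ => G₁) (G₂ := fun _ => G₂) (D₁ := fun _ => D₁)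
    (fun _ => hG₁) (fun _ => hG₂) (fun _ => hG₁pos) hc hm₂ hM₁ (fun _ => hm₂') (fun _ => hD₁)
    (fun _ => hM₁')
    (fun n => two_level_certificate_ext (𝕜 := 𝕜) (hG₁P n) (hG₂P n) (hPidem n) (hAn n)
      (htail n) (h₁ n))
    (fun n => weak_certificate_ext (𝕜 := 𝕜) (hG₂P n) (hPidem n) (hAn n) hμ₂
      (fun q _ => hG₂pos q) (h₂ n))
    (G := fun _ => G) (fun _ => hG) hm0 (fun _ => hm) (fun _ => hM)
    (fun n => strong_certificate_ext (𝕜 := 𝕜) (hGP n) (hPidem n) (hAn n) hμ₁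
      (fun q _ => hGpos q) (hL n))
    hcalg (fun n => bilinear_loss_proj (𝕜 := 𝕜) (hD₁P n) (hPidem n) (fun q _ => hD₁ q) hB)
    hv1 hgap hlam hε hx hres hCC' hsmall hw hw0 hw' hwW ht hχ

/-- **KILL (basin radius and decay) FOR THE TRUE TRAJECTORY FROM ONE HEAD∣TAIL CERTIFICATE.** Same
structural data as `half_prediction_of_head_tail_certificate` with a NEGATIVE two-level pair,
`ω < 2λ ≤ 0`, and strong abscissa `ω₁ ≤ λ`; put `C = √(M₁/(c m₂))·c_alg·√(π/(2λ − ω))`. For every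
seed `x ∈ Z` and `ε > 0` with `√(M/m)‖x‖ < ε` and `4Cε < 1`, every classical solution `w` of the
full system in `W` from `x` obeys `‖w t‖ ≤ 2 ε e^{λt}` at every `t ∈ [0, T]`. -/
theorem decay_two_of_head_tail_certificate (h : GalerkinConvergenceSetting P F W Z T l u)
    {A : E → E} {B : E → E → E} (hF : ∀ w ∈ W, F w = A w + B w w)
    (An : ℕ → E →L[ℝ] E) {μ : ℝ}
    (hAn : ∀ n, ∀ w : E, An n w = P n (A (P n w)) + ((μ : 𝕜) • (w - P n w)))
    {G₁ G₂ D₁ G : E →L[ℝ] E}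
    (hG₁ : ∀ x y : E, ⟪G₁ x, y⟫_𝕜 = ⟪x, G₁ y⟫_𝕜) (hG₂ : ∀ x y : E, ⟪G₂ x, y⟫_𝕜 = ⟪x, G₂ y⟫_𝕜)
    (hG : ∀ x y : E, ⟪G x, y⟫_𝕜 = ⟪x, G y⟫_𝕜)
    (hG₁P : ∀ n, ∀ w z : E, ⟪G₁ w, P n z⟫_𝕜 = ⟪G₁ (P n w), z⟫_𝕜)
    (hG₂P : ∀ n, ∀ w z : E, ⟪G₂ w, P n z⟫_𝕜 = ⟪G₂ (P n w), z⟫_𝕜)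
    (hD₁P : ∀ n, ∀ w z : E, ⟪D₁ w, P n z⟫_𝕜 = ⟪D₁ (P n w), z⟫_𝕜)
    (hGP : ∀ n, ∀ w z : E, ⟪G w, P n z⟫_𝕜 = ⟪G (P n w), z⟫_𝕜)
    (hG₁pos : ∀ x : E, 0 ≤ re ⟪G₁ x, x⟫_𝕜) {ω c m₂ M₁ : ℝ} (hc : 0 < c) (hm₂ : 0 < m₂)
    (hM₁ : 0 ≤ M₁) (hm₂' : ∀ x : E, m₂ * ‖x‖ ^ 2 ≤ re ⟪G₂ x, x⟫_𝕜)
    (hD₁ : ∀ x : E, 0 ≤ re ⟪D₁ x, x⟫_𝕜) (hM₁' : ∀ x : E, re ⟪G₁ x, x⟫_𝕜 ≤ M₁ * re ⟪D₁ x, x⟫_𝕜)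
    {m M ω₁ : ℝ} (hm0 : 0 < m) (hm : ∀ x : E, m * ‖x‖ ^ 2 ≤ re ⟪G x, x⟫_𝕜)
    (hM : ∀ x : E, re ⟪G x, x⟫_𝕜 ≤ M * ‖x‖ ^ 2)
    (h₁ : ∀ n, ∀ w : E, 2 * re ⟪G₁ (P n w), A (P n w)⟫_𝕜 + c * re ⟪G₂ (P n w), P n w⟫_𝕜 ≤
      2 * ω * re ⟪G₁ (P n w), P n w⟫_𝕜)
    (h₂ : ∀ n, ∀ w : E, re ⟪G₂ (P n w), A (P n w)⟫_𝕜 ≤ ω * re ⟪G₂ (P n w), P n w⟫_𝕜)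
    (hL : ∀ n, ∀ w : E, re ⟪G (P n w), A (P n w)⟫_𝕜 ≤ ω₁ * re ⟪G (P n w), P n w⟫_𝕜)
    (hμ₁ : μ ≤ ω₁) (hμ₂ : μ ≤ ω)
    (htail : ∀ n, ∀ q : E, P n q = 0 →
      2 * μ * re ⟪G₁ q, q⟫_𝕜 + c * re ⟪G₂ q, q⟫_𝕜 ≤ 2 * ω * re ⟪G₁ q, q⟫_𝕜)
    {lam : ℝ} (hgap : ω < 2 * lam) (hlam : lam ≤ 0) (hrate : ω₁ ≤ lam)
    {calg : ℝ} (hcalg : 0 ≤ calg)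
    (hB : ∀ x y : E, Real.sqrt (re ⟪D₁ (B x y), B x y⟫_𝕜) ≤ calg * ‖x‖ * ‖y‖)
    {x : E} (hx : x ∈ Z) {ε : ℝ} (hε : 0 < ε) (hseed : Real.sqrt (M / m) * ‖x‖ < ε)
    (hbasin : 4 * (Real.sqrt (M₁ / (c * m₂)) * calg * Real.sqrt (Real.pi / (2 * lam - ω))) * ε < 1)
    {w : ℝ → E} (hw : ContinuousOn w (Icc 0 T)) (hw0 : w 0 = x)
    (hw' : ∀ t ∈ Ioo 0 T, HasDerivAt w (F (w t)) t) (hwW : ∀ t ∈ Icc 0 T, w t ∈ W) :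
    ∀ t ∈ Icc 0 T, ‖w t‖ ≤ 2 * (ε * Real.exp (lam * t)) := by
  have hPidem : ∀ n, ∀ w : E, P n (P n w) = P n w := fun n w => h.proj_comp n n le_rfl w
  have hG₂pos : ∀ x : E, 0 ≤ re ⟪G₂ x, x⟫_𝕜 := fun x =>
    le_trans (mul_nonneg hm₂.le (sq_nonneg _)) (hm₂' x)
  have hGpos : ∀ x : E, 0 ≤ re ⟪G x, x⟫_𝕜 := fun x =>
    le_trans (mul_nonneg hm0.le (sq_nonneg _)) (hm x)
  exact decay_two_of_galerkin_limit (𝕜 := 𝕜) h An (fun n x y => P n (B x y))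
    (fun n => galerkin_field_ext (𝕜 := 𝕜) hF (hAn n))
    (G₁ := fun _ => G₁) (G₂ := fun _ => G₂) (D₁ := fun _ => D₁)
    (fun _ => hG₁) (fun _ => hG₂) (fun _ => hG₁pos) hc hm₂ hM₁ (fun _ => hm₂') (fun _ => hD₁)
    (fun _ => hM₁')
    (fun n => two_level_certificate_ext (𝕜 := 𝕜) (hG₁P n) (hG₂P n) (hPidem n) (hAn n)
      (htail n) (h₁ n))
    (fun n => weak_certificate_ext (𝕜 := 𝕜) (hG₂P n) (hPidem n) (hAn n) hμ₂
      (fun q _ => hG₂pos q) (h₂ n))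
    (G := fun _ => G) (fun _ => hG) hm0 (fun _ => hm) (fun _ => hM)
    (fun n => strong_certificate_ext (𝕜 := 𝕜) (hGP n) (hPidem n) (hAn n) hμ₁
      (fun q _ => hGpos q) (hL n))
    hgap hlam hrate hcalg
    (fun n => bilinear_loss_proj (𝕜 := 𝕜) (hD₁P n) (hPidem n) (fun q _ => hD₁ q) hB)
    hx hε hseed hbasin hw hw0 hw' hwW

end Summit.NavierStokesRegularity.FluidComputer.GalerkinEmergenceCertificate

end
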